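import Summits.Ventures.YMGap.FlowData.RectTubeFluxSectors
import HarnessLib

/-!
# Venture YMGap, track Y3 FLOW-DATA — spatial TRANSLATIONS of the rectangular slice, the MOMENTUM-π averaging operator
# along an axis, and the (flux, transverse momentum π) sector energies of the tube transfer operator — DEFINITIONS

HONEST FRAMING: venture file of the cell `pub-ymgap` (QuantumFields programme), track Y3 (FLOW-DATA); companion
DEFINITIONS for `FlowData/RectTubeTransferOperator.lean`.  It TYPES the FLOW-TABLE's momentum-resolved flux rows — the
`2×1×1` tube's `E_y^π` («y-flux, x-momentum π») and `Δ_p = E_y^π − E_y` — by OPERATOR NORMS, exactly as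
`rectTubeFluxEnergy` types `E_e`: no spectral theorem is needed to state them.  Finite spatial torus `Π_i ℤ/(Ls i)`; no
number, no row, nothing about `L → ∞`, the continuum or a mass gap.

* `rectTranslate v a = a(· + v, ·)` — the spatial translation of a slice configuration by `v ∈ Π_i ℤ/(Ls i)`; it
  preserves the a-priori measure (`measurePreserving_rectTranslate`, a relabelling of the product); `rectTranslateOp Ls v`
  = `U_v ψ = ψ ∘ τ_v`, a linear isometry of `L²(rectSliceMeasure)` (`norm_rectTranslateOp_apply`), `U_0 = 1`,
  `U_{v+w} = U_w ∘ U_v`;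
* `zmodParitySign j = (−1)^{j.val}` on `ℤ/L` — a CHARACTER of `ℤ/L` when `L` is even (`zmodParitySign_add`);
* `rectMomentumPiOp Ls ν = (Ls ν)⁻¹ Σ_{j ∈ ℤ/(Ls ν)} (−1)^j U_{j ê_ν}` — for EVEN `Ls ν` the averaging of the unitary
  translations along `ν` against the character `(−1)^j`, i.e. the orthogonal projection onto momentum `π` along `ν`
  (`rectMomentumPiOp_comp_self`: idempotent for even `Ls ν`); `‖Π_ν‖ ≤ 1` always (`norm_rectMomentumPiOp_le_one`); a
  joint eigenvector `U_{jê_ν} ψ = (−1)^j ψ` is fixed by `Π_ν` (`rectMomentumPiOp_apply_of_eigen`).  For odd `Ls ν`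
  the operator is NOT a projection (there is no momentum `π`) and the attached energy below is a junk value;
* `rectTubeFluxMomentumPiNorm ρ z J Ls e ν = ‖T ∘ P_e ∘ Π_ν‖`, `rectTubeFluxMomentumPiEnergy … = log ‖T‖ − log ‖T ∘ P_e ∘ Π_ν‖`,
  and the cell's **`su2RectFluxMomentumPiEnergy β Ls e ν`** (`SU(2)` fundamental, twist `−1`, `J = β/2`): the energy
  of the lowest state of centre flux `e` and momentum `π` along `ν` above the vacuum (FLOW-PLAN O1 with a momentum
  label; `E_y^π` of the `2×1×1` rows is `e = ê_y`, `ν = x`).  REMARK (not used, not proved here): twists and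
  translations commute up to a central layer gauge transformation, which `T` annihilates (`RectTubeGaugeInvariance`),
  so on gauge-invariant states `P_e` and `Π_ν` commute and `‖T ∘ P_e ∘ Π_ν‖` is the top of `T` on the joint sector;
* `rectTubeFluxMomentumPiNorm_le` — `‖T ∘ P_e ∘ Π_ν‖ ≤ ‖T ∘ P_e‖`, hence **`rectTubeFluxEnergy_le_fluxMomentumPiEnergy`**:
  `E_e ≤ E_{e,π_ν}` as soon as the `(e, π_ν)` sector is not annihilated — the table's `Δ_p ≥ 0`, modulo the
  non-annihilation proved in `FlowData/RectTubeMomentumPiStates.lean`.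

References: G. 't Hooft, Nucl. Phys. B 153 (1979) 141 [cite: tHooft1979Flux]; M. Lüscher, Commun. Math. Phys. 54
(1977) 283 [cite: Luscher1977]; I. Montvay, G. Münster (1994) §3.2.6 [cite: MontvayMunster1994, §3.2.6].
-/

noncomputable section

open scoped BigOperators ENNReal
open MeasureTheory Filter Function
open Literature.MathematicalPhysics.QuantumFieldTheory Literature.Analysis.OperatorTheory
open Literature.MathematicalPhysics.QuantumLattice (RectTorusSite fundamentalRep)

namespace Summit.Ventures.YMGap.FlowData

/-! ### Translations of the slice configuration -/

section Translate

variable {G : Type*} {k : ℕ} {Ls : Fin k → ℕ}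

/-- **Spatial translation** of a slice configuration by `v ∈ Π_i ℤ/(Ls i)`: `(τ_v a)(x, i) = a(x + v, i)`. -/
def rectTranslate (v : RectTorusSite Ls) (a : RectSlice Ls G) : RectSlice Ls G :=
  fun e => a (e.1 + v, e.2)

/-- Pointwise formula of the translation. [folklore] -/
@[simp] theorem rectTranslate_apply (v : RectTorusSite Ls) (a : RectSlice Ls G) (e : RectTorusSite Ls × Fin k) :
    rectTranslate v a e = a (e.1 + v, e.2) := rfl

/-- `τ_0 = id`. [folklore] -/
theorem rectTranslate_zero (a : RectSlice Ls G) : rectTranslate (0 : RectTorusSite Ls) a = a := by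
  funext e
  rw [rectTranslate_apply, add_zero]

/-- `τ_{v+w} = τ_v ∘ τ_w`. [folklore] -/
theorem rectTranslate_add (v w : RectTorusSite Ls) (a : RectSlice Ls G) :
    rectTranslate (v + w) a = rectTranslate v (rectTranslate w a) := by
  funext e
  simp only [rectTranslate_apply]
  rw [add_assoc]

variable [Group G] [TopologicalSpace G] [IsTopologicalGroup G] [CompactSpace G] [MeasurableSpace G] [BorelSpace G]
  [∀ i, NeZero (Ls i)]

/-- **Translations preserve the a-priori measure** (a relabelling of the product of Haar measures). [folklore] -/
theorem measurePreserving_rectTranslate (v : RectTorusSite Ls) :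
    MeasurePreserving (rectTranslate (G := G) (Ls := Ls) v) (rectSliceMeasure G Ls) (rectSliceMeasure G Ls) := by
  have h := measurePreserving_piCongrLeft (fun _ : RectTorusSite Ls × Fin k => haarProbability G)
    ((Equiv.subRight v).prodCongr (Equiv.refl (Fin k)))
  have he : (⇑(MeasurableEquiv.piCongrLeft (fun _ : RectTorusSite Ls × Fin k => G)
      ((Equiv.subRight v).prodCongr (Equiv.refl (Fin k))))) = rectTranslate (G := G) (Ls := Ls) v := by
    funext a e
    simp only [MeasurableEquiv.coe_piCongrLeft, Equiv.piCongrLeft_apply_eq_cast, cast_eq, Equiv.prodCongr_symm,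
      Equiv.prodCongr_apply, Prod.map, Equiv.refl_symm, Equiv.coe_refl, id, rectTranslate_apply,
      Equiv.subRight_symm_apply]
  rw [he] at h
  exact h

variable (Ls) in
/-- **The translation operator** `U_v ψ = ψ ∘ τ_v` on `L²(rectSliceMeasure)` (a linear isometry). [folklore] -/
def rectTranslateOp (v : RectTorusSite Ls) :
    Lp ℝ 2 (rectSliceMeasure G Ls) →L[ℝ] Lp ℝ 2 (rectSliceMeasure G Ls) :=
  (Lp.compMeasurePreservingₗᵢ ℝ (rectTranslate (G := G) (Ls := Ls) v)
    (measurePreserving_rectTranslate v)).toContinuousLinearMap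

/-- `U_v ψ = ψ ∘ τ_v` a.e. [folklore] -/
theorem rectTranslateOp_ae_eq (v : RectTorusSite Ls) (ψ : Lp ℝ 2 (rectSliceMeasure G Ls)) :
    (rectTranslateOp Ls v ψ : RectSlice Ls G → ℝ) =ᵐ[rectSliceMeasure G Ls]
      (ψ : RectSlice Ls G → ℝ) ∘ rectTranslate v :=
  Lp.coeFn_compMeasurePreserving ψ (measurePreserving_rectTranslate v)

/-- `‖U_v ψ‖ = ‖ψ‖`. [folklore] -/
theorem norm_rectTranslateOp_apply (v : RectTorusSite Ls) (ψ : Lp ℝ 2 (rectSliceMeasure G Ls)) :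
    ‖rectTranslateOp Ls v ψ‖ = ‖ψ‖ :=
  Lp.norm_compMeasurePreserving ψ (measurePreserving_rectTranslate v)

/-- `‖U_v‖ ≤ 1`. [folklore] -/
theorem norm_rectTranslateOp_le_one (v : RectTorusSite Ls) : ‖rectTranslateOp (G := G) Ls v‖ ≤ 1 :=
  ContinuousLinearMap.opNorm_le_bound _ zero_le_one fun ψ => by
    rw [one_mul, norm_rectTranslateOp_apply]

/-- The `L²` class of a function composed with a translation: `U_v [f] = [f ∘ τ_v]`. [folklore] -/
theorem rectTranslateOp_toLp (v : RectTorusSite Ls) {f : RectSlice Ls G → ℝ} (hf : MemLp f 2 (rectSliceMeasure G Ls)) :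
    rectTranslateOp Ls v (hf.toLp f) =
      (hf.comp_measurePreserving (measurePreserving_rectTranslate v)).toLp (f ∘ rectTranslate v) := by
  apply Lp.ext
  have h1 := rectTranslateOp_ae_eq (Ls := Ls) v (hf.toLp f)
  have h2 : ((hf.toLp f : Lp ℝ 2 (rectSliceMeasure G Ls)) : RectSlice Ls G → ℝ) ∘ rectTranslate v
      =ᵐ[rectSliceMeasure G Ls] f ∘ rectTranslate v :=
    (measurePreserving_rectTranslate (G := G) (Ls := Ls) v).quasiMeasurePreserving.ae_eq_comp hf.coeFn_toLp
  exact (h1.trans h2).trans (MemLp.coeFn_toLp _).symm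

/-- `U_0 = 1`. [folklore] -/
theorem rectTranslateOp_zero : rectTranslateOp (G := G) Ls (0 : RectTorusSite Ls) = 1 := by
  apply ContinuousLinearMap.ext fun ψ => ?_
  apply Lp.ext
  have h1 := rectTranslateOp_ae_eq (Ls := Ls) (0 : RectTorusSite Ls) ψ
  have h0 : rectTranslate (G := G) (Ls := Ls) 0 = id := funext fun a => rectTranslate_zero a
  rw [h0, Function.comp_id] at h1
  exact h1

/-- **Group law**: `U_{v+w} = U_w ∘ U_v` (`ψ ∘ τ_{v+w} = (ψ ∘ τ_v) ∘ τ_w`). [folklore] -/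
theorem rectTranslateOp_add (v w : RectTorusSite Ls) :
    rectTranslateOp (G := G) Ls (v + w) = (rectTranslateOp Ls w).comp (rectTranslateOp Ls v) := by
  apply ContinuousLinearMap.ext fun ψ => ?_
  apply Lp.ext
  have h1 := rectTranslateOp_ae_eq (Ls := Ls) (v + w) ψ
  have h2 := rectTranslateOp_ae_eq (Ls := Ls) w (rectTranslateOp Ls v ψ)
  have h3 : ((rectTranslateOp Ls v ψ : Lp ℝ 2 (rectSliceMeasure G Ls)) : RectSlice Ls G → ℝ) ∘ rectTranslate w
      =ᵐ[rectSliceMeasure G Ls] ((ψ : RectSlice Ls G → ℝ) ∘ rectTranslate v) ∘ rectTranslate w :=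
    (measurePreserving_rectTranslate (G := G) (Ls := Ls) w).quasiMeasurePreserving.ae_eq_comp
      (rectTranslateOp_ae_eq (Ls := Ls) v ψ)
  have h4 : ((ψ : RectSlice Ls G → ℝ) ∘ rectTranslate v) ∘ rectTranslate w =
      (ψ : RectSlice Ls G → ℝ) ∘ rectTranslate (G := G) (Ls := Ls) (v + w) := by
    funext a
    simp only [Function.comp_apply, rectTranslate_add]
  rw [h4] at h3
  rw [ContinuousLinearMap.comp_apply]
  exact h1.trans (h2.trans h3).symm

/-- Translations along one axis compose additively: `U_{(i+j) ê_ν} = U_{j ê_ν} ∘ U_{i ê_ν}`. [folklore] -/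
theorem rectTranslateOp_single_add (ν : Fin k) (i j : ZMod (Ls ν)) :
    rectTranslateOp (G := G) Ls (Pi.single ν (i + j) : RectTorusSite Ls) =
      (rectTranslateOp Ls (Pi.single ν j)).comp (rectTranslateOp Ls (Pi.single ν i)) := by
  rw [Pi.single_add, rectTranslateOp_add]

end Translate

/-! ### The parity character of `ℤ/L` (`L` even) and the momentum-π averaging operator -/

section MomentumPi

/-- The **parity sign** `(−1)^{j}` of a residue `j ∈ ℤ/L` (through its canonical representative `j.val`). -/
def zmodParitySign {L : ℕ} (j : ZMod L) : ℝ := (-1) ^ j.val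

/-- `(−1)^0 = 1`. [folklore] -/
@[simp] theorem zmodParitySign_zero {L : ℕ} : zmodParitySign (0 : ZMod L) = 1 := by
  simp [zmodParitySign, ZMod.val_zero]

/-- `((−1)^j)² = 1`. [folklore] -/
theorem zmodParitySign_mul_self {L : ℕ} (j : ZMod L) : zmodParitySign j * zmodParitySign j = 1 := by
  rw [zmodParitySign, ← pow_add, ← two_mul, pow_mul, neg_one_sq, one_pow]

/-- `|(−1)^j| = 1`. [folklore] -/
theorem abs_zmodParitySign {L : ℕ} (j : ZMod L) : |zmodParitySign j| = 1 := by
  rw [zmodParitySign, abs_pow, abs_neg, abs_one, one_pow]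

/-- **For even `L` the parity sign is a character of `ℤ/L`**: `(−1)^{i+j} = (−1)^i (−1)^j`. [folklore] -/
theorem zmodParitySign_add {L : ℕ} [NeZero L] (hL : Even L) (i j : ZMod L) :
    zmodParitySign (i + j) = zmodParitySign i * zmodParitySign j := by
  unfold zmodParitySign
  rw [← pow_add, ZMod.val_add]
  set n : ℕ := i.val + j.val with hn
  conv_rhs => rw [← Nat.mod_add_div n L]
  rw [pow_add, pow_mul, Even.neg_one_pow hL, one_pow, mul_one]

variable {G : Type*} [Group G] [TopologicalSpace G] [IsTopologicalGroup G] [CompactSpace G] [MeasurableSpace G]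
  [BorelSpace G] {k : ℕ} (Ls : Fin k → ℕ) [∀ i, NeZero (Ls i)]

/-- **The momentum-π averaging operator along the axis `ν`**: `Π_ν = (Ls ν)⁻¹ Σ_{j ∈ ℤ/(Ls ν)} (−1)^j U_{j ê_ν}`.
For EVEN `Ls ν` this is the orthogonal projection onto the functions of momentum `π` along `ν`
(`U_{ê_ν} ψ = −ψ`); for odd `Ls ν` it is not a projection. [cite: Luscher1977] -/
def rectMomentumPiOp (ν : Fin k) : Lp ℝ 2 (rectSliceMeasure G Ls) →L[ℝ] Lp ℝ 2 (rectSliceMeasure G Ls) :=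
  ((Ls ν : ℝ))⁻¹ • ∑ j : ZMod (Ls ν), zmodParitySign j • rectTranslateOp Ls (Pi.single ν j : RectTorusSite Ls)

variable {Ls}

/-- `‖Π_ν‖ ≤ 1` (an average of `Ls ν` isometries with unimodular signs). [folklore] -/
theorem norm_rectMomentumPiOp_le_one (ν : Fin k) : ‖rectMomentumPiOp (G := G) Ls ν‖ ≤ 1 := by
  unfold rectMomentumPiOp
  have hL : (0 : ℝ) < (Ls ν : ℝ) := by exact_mod_cast Nat.pos_of_ne_zero (NeZero.ne (Ls ν))
  rw [norm_smul, norm_inv, Real.norm_of_nonneg hL.le]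
  have hsum : ‖∑ j : ZMod (Ls ν), zmodParitySign j • rectTranslateOp (G := G) Ls (Pi.single ν j : RectTorusSite Ls)‖ ≤
      (Ls ν : ℝ) := by
    calc ‖∑ j : ZMod (Ls ν), zmodParitySign j • rectTranslateOp (G := G) Ls (Pi.single ν j : RectTorusSite Ls)‖
        ≤ ∑ j : ZMod (Ls ν), ‖zmodParitySign j • rectTranslateOp (G := G) Ls (Pi.single ν j : RectTorusSite Ls)‖ :=
          norm_sum_le _ _
      _ ≤ ∑ _j : ZMod (Ls ν), (1 : ℝ) := Finset.sum_le_sum fun j _ => by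
          rw [norm_smul, Real.norm_eq_abs, abs_zmodParitySign, one_mul]
          exact norm_rectTranslateOp_le_one _
      _ = (Ls ν : ℝ) := by simp [Finset.card_univ, ZMod.card]
  calc ((Ls ν : ℝ))⁻¹ * ‖∑ j : ZMod (Ls ν), zmodParitySign j • rectTranslateOp (G := G) Ls (Pi.single ν j : RectTorusSite Ls)‖
      ≤ ((Ls ν : ℝ))⁻¹ * (Ls ν : ℝ) := mul_le_mul_of_nonneg_left hsum (inv_nonneg.2 hL.le)
    _ = 1 := inv_mul_cancel₀ hL.ne'

/-- **A joint eigenvector of the translations along `ν` with eigenvalues `(−1)^j` is fixed by `Π_ν`.** [folklore] -/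
theorem rectMomentumPiOp_apply_of_eigen (ν : Fin k) {ψ : Lp ℝ 2 (rectSliceMeasure G Ls)}
    (hψ : ∀ j : ZMod (Ls ν), rectTranslateOp Ls (Pi.single ν j : RectTorusSite Ls) ψ = zmodParitySign j • ψ) :
    rectMomentumPiOp Ls ν ψ = ψ := by
  unfold rectMomentumPiOp
  rw [_root_.smul_apply, _root_.sum_apply]
  simp_rw [_root_.smul_apply, hψ, smul_smul, zmodParitySign_mul_self, one_smul, Finset.sum_const,
    Finset.card_univ, ZMod.card]
  rw [← Nat.cast_smul_eq_nsmul ℝ, smul_smul]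
  have hL : (Ls ν : ℝ) ≠ 0 := by exact_mod_cast NeZero.ne (Ls ν)
  rw [inv_mul_cancel₀ hL, one_smul]

/-- **For even `Ls ν`, `Π_ν` is idempotent** (`Π_ν² = (Ls ν)⁻² Σ_{i,j} (−1)^{i+j} U_{(i+j)ê_ν} = Π_ν`). [folklore] -/
theorem rectMomentumPiOp_comp_self (ν : Fin k) (hL : Even (Ls ν)) :
    (rectMomentumPiOp (G := G) Ls ν).comp (rectMomentumPiOp Ls ν) = rectMomentumPiOp Ls ν := by
  have hL0 : (Ls ν : ℝ) ≠ 0 := by exact_mod_cast NeZero.ne (Ls ν)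
  unfold rectMomentumPiOp
  rw [ContinuousLinearMap.comp_smul, ContinuousLinearMap.smul_comp, smul_smul, ContinuousLinearMap.comp_finsetSum]
  simp_rw [ContinuousLinearMap.finsetSum_comp, ContinuousLinearMap.comp_smul, ContinuousLinearMap.smul_comp, smul_smul]
  -- after distributing: `Σ_j Σ_i ((−1)^j (−1)^i) • (U_i ∘ U_j)`; reindex the inner sum by `i ↦ j + i`
  have hinner : ∀ j : ZMod (Ls ν),
      ∑ i : ZMod (Ls ν), (zmodParitySign j * zmodParitySign i) •
          (rectTranslateOp (G := G) Ls (Pi.single ν i : RectTorusSite Ls)).comp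
            (rectTranslateOp Ls (Pi.single ν j : RectTorusSite Ls)) =
        ∑ m : ZMod (Ls ν), zmodParitySign m • rectTranslateOp (G := G) Ls (Pi.single ν m : RectTorusSite Ls) := by
    intro j
    have h : ∀ i : ZMod (Ls ν), (zmodParitySign j * zmodParitySign i) •
        (rectTranslateOp (G := G) Ls (Pi.single ν i : RectTorusSite Ls)).comp
          (rectTranslateOp Ls (Pi.single ν j : RectTorusSite Ls)) =
        zmodParitySign (j + i) • rectTranslateOp (G := G) Ls (Pi.single ν (j + i) : RectTorusSite Ls) := by
      intro i
      rw [← zmodParitySign_add hL, rectTranslateOp_single_add ν j i]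
    simp_rw [h]
    exact Equiv.sum_comp (Equiv.addLeft j)
      (fun m : ZMod (Ls ν) => zmodParitySign m • rectTranslateOp (G := G) Ls (Pi.single ν m : RectTorusSite Ls))
  simp_rw [hinner]
  rw [Finset.sum_const, Finset.card_univ, ZMod.card, ← Nat.cast_smul_eq_nsmul ℝ, smul_smul]
  congr 1
  field_simp

end MomentumPi

/-! ### The (flux, momentum π) sector energies of the rectangular tube -/

section Energies

variable {G : Type*} [Group G] [TopologicalSpace G] [IsTopologicalGroup G] [CompactSpace G]
  [MeasurableSpace G] [BorelSpace G] {n k : ℕ} (ρ : G →* Matrix (Fin n) (Fin n) ℂ) (z : G) (J : ℝ)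
  (Ls : Fin k → ℕ) [∀ i, NeZero (Ls i)]

/-- The **sector norm** `‖T ∘ P_e ∘ Π_ν‖` of centre flux `e` and momentum `π` along `ν` (FLOW-PLAN's `λ̂₀^{(e, p_ν = π)}`
up to the common scalar). -/
def rectTubeFluxMomentumPiNorm (e : Fin k → ZMod 2) (ν : Fin k) : ℝ :=
  ‖(rectTubeTransferOperator ρ J Ls).comp ((rectTubeFluxProjection z Ls e).comp (rectMomentumPiOp Ls ν))‖

/-- **The energy of the lowest state of centre flux `e` and momentum `π` along `ν`** above the vacuum:
`E_{e,π_ν} = log ‖T‖ − log ‖T ∘ P_e ∘ Π_ν‖` (junk value when the sector is annihilated or `Ls ν` is odd). -/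
def rectTubeFluxMomentumPiEnergy (e : Fin k → ZMod 2) (ν : Fin k) : ℝ :=
  Real.log ‖rectTubeTransferOperator ρ J Ls‖ - Real.log (rectTubeFluxMomentumPiNorm ρ z J Ls e ν)

/-- **`‖T ∘ P_e ∘ Π_ν‖ ≤ ‖T ∘ P_e‖`** (`‖Π_ν‖ ≤ 1`): a momentum label can only lower the sector top. [folklore] -/
theorem rectTubeFluxMomentumPiNorm_le (e : Fin k → ZMod 2) (ν : Fin k) :
    rectTubeFluxMomentumPiNorm ρ z J Ls e ν ≤ rectTubeSectorNorm ρ z J Ls e := by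
  unfold rectTubeFluxMomentumPiNorm rectTubeSectorNorm sectorNorm
  rw [← ContinuousLinearMap.comp_assoc]
  calc ‖((rectTubeTransferOperator ρ J Ls).comp (fluxProjection (rectFluxTwistOp Ls z) e)).comp (rectMomentumPiOp Ls ν)‖
      ≤ ‖(rectTubeTransferOperator ρ J Ls).comp (fluxProjection (rectFluxTwistOp Ls z) e)‖ * ‖rectMomentumPiOp Ls ν‖ :=
        ContinuousLinearMap.opNorm_comp_le _ _
    _ ≤ ‖(rectTubeTransferOperator ρ J Ls).comp (fluxProjection (rectFluxTwistOp Ls z) e)‖ * 1 :=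
        mul_le_mul_of_nonneg_left (norm_rectMomentumPiOp_le_one ν) (norm_nonneg _)
    _ = _ := mul_one _

/-- **`E_e ≤ E_{e,π_ν}`** whenever the `(e, π_ν)` sector is not annihilated by `T`: the table's `Δ_p = E^π − E ≥ 0`
(modulo non-annihilation, `FlowData/RectTubeMomentumPiStates.lean`). [folklore] -/
theorem rectTubeFluxEnergy_le_fluxMomentumPiEnergy (e : Fin k → ZMod 2) (ν : Fin k)
    (hpos : 0 < rectTubeFluxMomentumPiNorm ρ z J Ls e ν) :
    rectTubeFluxEnergy ρ z J Ls e ≤ rectTubeFluxMomentumPiEnergy ρ z J Ls e ν := by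
  unfold rectTubeFluxMomentumPiEnergy rectTubeFluxEnergy fluxEnergy
  have h := Real.log_le_log hpos (rectTubeFluxMomentumPiNorm_le ρ z J Ls e ν)
  change Real.log ‖rectTubeTransferOperator ρ J Ls‖ - Real.log (rectTubeSectorNorm ρ z J Ls e) ≤ _
  linarith

end Energies

/-! ### The cell's object: `SU(2)`, fundamental representation, `z = −1`, Wilson coupling `β_W` -/

section SU2

/-- **The cell's (flux, momentum π) energies on a rectangular cross-section**: `SU(2)`, fundamental representation,
`z = −1`, Wilson coupling `β ≡ β_W` (`J = β/2`); `E_y^π` of the FLOW-TABLE's `2×1×1` rows is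
`su2RectFluxMomentumPiEnergy β Ls (Pi.single y 1) x`. -/
def su2RectFluxMomentumPiEnergy {k : ℕ} (β : ℝ) (Ls : Fin k → ℕ) [∀ i, NeZero (Ls i)] (e : Fin k → ZMod 2)
    (ν : Fin k) : ℝ :=
  rectTubeFluxMomentumPiEnergy (fundamentalRep (Fin 2)) su2MinusOne (β / 2) Ls e ν

/-- The cell's (flux, momentum π) sector top `‖T ∘ P_e ∘ Π_ν‖`. -/
def su2RectFluxMomentumPiNorm {k : ℕ} (β : ℝ) (Ls : Fin k → ℕ) [∀ i, NeZero (Ls i)] (e : Fin k → ZMod 2)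
    (ν : Fin k) : ℝ :=
  rectTubeFluxMomentumPiNorm (fundamentalRep (Fin 2)) su2MinusOne (β / 2) Ls e ν

end SU2

end Summit.Ventures.YMGap.FlowData
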